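import Summits.QuantumFields.YangMills.Theorems.BalabanUVNodesN15PerCubeGreenProjection
import Summits.QuantumFields.YangMills.Theorems.BalabanUVNodesN15CurvedGluingCubeDressedGeneralGauge
import HarnessLib

/-!
# N15 = NE2, road (c) — PROGRAMME (PC), towards (PC-D): THE CLOSENESS OF `(Q′G′²Q′ᵀ)⁻¹` TO ITS FLAT VALUE IN THE CUBE's GAUGE — `𝕎_□S(U)⁻¹𝕎_□ᵀ − S(𝟙)⁻¹ ≤ (Σ(r_V) + e^{−δd_Z(y)})·B(L^k)^{d+1}e^{−δd}`
# with a LIPSCHITZ distance minorant `d_Z ≥ w` on `supp h_□` (dag-n15-c g28, n15-c∕299i)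

Cell `pub-ymgap`, seat `pub-ymgap-dag-n15-c` (generation g28; R134 (a), s1; HUMAN RULING D-0062).  `bears_on: R4∕N15 · K3⁸ SpineGivenEndpointR13SepCoPHV (stmt-QuantumFields-27366)`;
filed `--kind proof --supports stmt-QuantumFields-27366 --as helper` — COUNT-NEUTRAL.  0 `def`, 0 `sorry`.  Imports n15-c∕299g `…PerCubeGreenProjection` (through it ★★★★ 299e
`hasMaj_cSop_inv_of_reg335BigBox`, 299a `hasMaj_cSop_sub_cSop_one_of_reg335_scaled`, 299b `exists_farZone`, 222b `flatSopRow_ct_uniform`, 214 `isUnit_cSop`, 297's weighted kernels,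
`reg335Cube_box2_of_bigBox`), dag-n15-w2 g4 `…CurvedGluingCubeDressedGeneralGauge` (`hasMaj_gaugeConj`).  Nothing in the tree is modified.

WHY ((PC-D): the Landau LETTER per cube is the CLOSENESS of `landauCov(U^{u_□})` to `landauCov(𝟙)` near `□`; its coarse factor is `S⁻¹`).  `S(V)⁻¹ − S(𝟙)⁻¹ = S(𝟙)⁻¹(S(𝟙) − S(V))S(V)⁻¹`
(`V = U^{u_□}`, `S(V) = 𝕎S(U)𝕎ᵀ`, `S(V)⁻¹ = 𝕎S(U)⁻¹𝕎ᵀ`): the middle factor is 299a's closeness `(Σ + e^{−δd_Z(y)})·B(L^k)^{−(d+1)}e^{−δd}` at its OUTPUT, the outer factors are `C_S(L^k)^{d+1}`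
(222b) and `|ι|²B(L^k)^{d+1}` (299e conjugated, `hasMaj_gaugeConj`); the weight is moved from the middle to the output by 297's `hasMaj_comp_nfW`, which needs the LIPSCHITZ minorant
property of `d_Z` — exported here (299d kept only `d_Z ≥ 0` and the margin): ★★★ `exists_gaugedSopInv_close`.

HONEST FRAMING ∕ LIMITS.  MODEL carriers (n15-c∕262's cover, `L ≥ 11`, class asked on the walk-locality boxes); [B9] cited for SHAPES ∕ MECHANISM; no operator of record estimated.
NE2⁺ NOT PRINTED, NOT proved; N15 of record untouched; K3⁸ OPEN; counts UNMOVED.  Restate-immune (no Theses import).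
-/

noncomputable section

open scoped BigOperators Matrix Matrix.Norms.L2Operator

namespace Summit.QuantumFields.YangMills.BalabanUVNodes.N15.Gluing

open Real
open Literature.MathematicalPhysics.QuantumFieldTheory.Balaban1983to89
open Literature.MathematicalPhysics.QuantumFieldTheory.Balaban1983to89.B5Prop11Plancherel (Tor fine unitVec)
open Literature.MathematicalPhysics.QuantumFieldTheory.Balaban1983to89.B5Block118 (up bpt)
open Literature.MathematicalPhysics.QuantumFieldTheory.Balaban1983to89.B11SectG (BlockNorm HasMaj RowSum)
open Literature.MathematicalPhysics.QuantumFieldTheory.Balaban1983to89.B6RandomWalk (Triangle254)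
open Literature.MathematicalPhysics.QuantumFieldTheory.Balaban1983to89.B6UnitTorusCarrier (unitTorusGeo triangle254_unitTorusGeo rowSum_unitTorusGeo unitTorusGeo_dist_nonneg unitTorusGeo_dist_self)
open Literature.MathematicalPhysics.QuantumFieldTheory.Balaban1983to89.B9Eq335RegularityClasses (Reg335Cube)
open Literature.MathematicalPhysics.QuantumFieldTheory.Balaban1983to89.B9Eq336RegularityClassesOrbit (reg335Cube_gaugeTr)
open Literature.MathematicalPhysics.QuantumFieldTheory.Balaban1983to89.B9Eq3117Current (gaugeTr gaugeTr_one)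
open Literature.MathematicalPhysics.QuantumFieldTheory.Balaban1983to89.B9Eq39Adjoint (covD fluct)
open Summit.QuantumFields.YangMills.BalabanUVNodes.N15.CovLandau (cSop cSop_gauge bdiag bdiag_transpose bdiag_mul_bdiag bdiag_one flatSopRow_ct_uniform isUnit_cSop mulVecLin_sub')
open Summit.QuantumFields.YangMills.BalabanUVNodes.N15.BackgroundModel (kappa_ofBlocks)
open Literature.MathematicalPhysics.QuantumFieldTheory.King1986 (aK aK_pos aK_le aK_ge)
open Literature.MathematicalPhysics.QuantumFieldTheory.King1986.Torus (blockOf)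
open Literature.Barriers.QuantumFields (traceForm)
open Summit.QuantumFields.YangMills.BalabanUVNodes.N15.MatrixSpecies (mmulOp coordMat basisConst liftBlk mmulOp_comp_mmulOp)
open Summit.QuantumFields.YangMills.BalabanUVNodes.N15.TwoGrid (cubeBlocks hasMaj_smul_ofBlocks)
open Summit.QuantumFields.YangMills.BalabanUVNodes.N15.CurvedSpecies (uN_val_gaugeTr_eq uN_val_inv_eq_conjTranspose uN_coordMat_conj_orthogonal hasMaj_gaugeConj mmulOp_one)

variable {d : ℕ}

section Close

variable {L : ℕ} [NeZero L]

set_option maxHeartbeats 800000 in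
/-- ★★★ **THE CLOSENESS OF `S(U)⁻¹` IN THE CUBE's GAUGE TO THE FLAT `S(𝟙)⁻¹`, WITH A LIPSCHITZ DISTANCE MINORANT.**  Under n15-c∕299e's hypotheses: for every cube `k` there are an orthogonal
coarse gauge `𝕎` (the class gauge `u_k` at block corners) and `d_Z : 𝕋 → ℝ` with `0 ≤ d_Z`, `d_Z(y) ≤ |y − z| + d_Z(z)`, `d_Z ≥ L^m` on `supp h_k`, such that
`M_𝕎 ∘ mulVecLin S(U)⁻¹ ∘ M_{𝕎ᵀ} − mulVecLin S(𝟙)⁻¹ ≤ (Σ(r_V) + e^{−δd_Z(y)})·B(L^k)^{d+1}e^{−δ|y−y′|}` (`Σ(r_V) = r_V(1+|J⊕J|) + a_K|ι|(|ι|σ²+2σ) + σ + (L^m)⁻¹`).  MODEL carriers; the SHAPE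
of [B9] Cor. 3.8's locality for the operator `(Q′G′²Q′*)⁻¹`. [cite: Balaban1985BackgroundPropagators, Cor. 3.8 p.410, (3.95)–(3.96) p.411, (3.34)–(3.35) p.396 (shapes ∕ mechanism); Balaban1984PropagatorsI, (1.20) p.20] -/
theorem exists_gaugedSopInv_close (hL : Odd L ∧ 1 < L) (hL11 : 11 ≤ L) {a₀ : ℝ} (ha₀ : 0 < a₀) (ι : Type) [Fintype ι] [DecidableEq ι] :
    ∃ δ w₀ R₀ B : ℝ, 0 < δ ∧ 0 < R₀ ∧ 0 < B ∧
      ∀ (mv kk : ℕ), 1 ≤ kk → w₀ ≤ ((L ^ mv : ℕ) : ℝ) →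
      ∀ {mm : Type} [Fintype mm] [DecidableEq mm] [Nonempty mm] (e : Matrix mm mm ℂ ≃L[ℝ] (ι → ℝ)), (∀ A B : Matrix mm mm ℂ, traceForm A B = e A ⬝ᵥ e B) →
      ∀ (U : Fin (d + 1) → ScX d L mv kk hL → (Matrix mm mm ℂ)ˣ), (∀ μ x, (U μ x : Matrix mm mm ℂ) ∈ Matrix.unitaryGroup mm ℂ) →
      ∀ (ξ C : ℝ), 0 < ξ → 0 < C →
        (∀ k : Fin (d + 1) → ZMod (2 * L), ∃ (u : ScX d L mv kk hL → (Matrix mm mm ℂ)ˣ) (A : Fin (d + 1) → ScX d L mv kk hL → Matrix mm mm ℂ),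
          (∀ x, (u x : Matrix mm mm ℂ) ∈ Matrix.unitaryGroup mm ℂ) ∧
          (∀ μ, ∀ z ∈ {x : ScX d L mv kk hL | blockOf (L ^ kk) (cvM d L mv kk hL) x ∈ cubeBlocks (cvM d L mv kk hL) (coverCorner (cvM d L mv kk hL) (L ^ mv) L (L * L ^ mv + 3 * L ^ mv - 1 - coverMargin L mv) k) (L * L ^ mv + 10 * L ^ mv)},
              gaugeTr (scShift d L mv kk hL) u U μ z = fluct ((((L ^ kk : ℕ) : ℝ))⁻¹) A μ z) ∧
          (∀ μ, ∀ z ∈ {x : ScX d L mv kk hL | blockOf (L ^ kk) (cvM d L mv kk hL) x ∈ cubeBlocks (cvM d L mv kk hL) (coverCorner (cvM d L mv kk hL) (L ^ mv) L (L * L ^ mv + 3 * L ^ mv - 1 - coverMargin L mv) k) (L * L ^ mv + 10 * L ^ mv)},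
              ‖A μ z‖ < C * ξ⁻¹) ∧
          (∀ μ ν, ∀ z ∈ {x : ScX d L mv kk hL | blockOf (L ^ kk) (cvM d L mv kk hL) x ∈ cubeBlocks (cvM d L mv kk hL) (coverCorner (cvM d L mv kk hL) (L ^ mv) L (L * L ^ mv + 3 * L ^ mv - 1 - coverMargin L mv) k) (L * L ^ mv + 10 * L ^ mv)},
              ‖((↑((((L ^ kk : ℕ) : ℝ))⁻¹) : ℂ)⁻¹) • covD (scShift d L mv kk hL) (fun _ _ => (1 : (Matrix mm mm ℂ)ˣ)) μ (A ν) z‖ < C * (ξ ^ 2)⁻¹)) →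
      ∀ (rV : ℝ), 0 ≤ rV →
        Fintype.card ι * (@basisConst ι _ (Matrix mm mm ℂ) Matrix.frobeniusNormedAddCommGroup Matrix.frobeniusNormedSpace e * (2 * Real.sqrt (Fintype.card mm)) * (Real.sqrt (Fintype.card mm) * ((C / ξ) * Real.exp (((((L ^ kk : ℕ) : ℝ))⁻¹) * (C / ξ))))) ≤ rV →
        Fintype.card ι * (Fintype.card (Fin (d + 1)) * (Fintype.card ι * (@basisConst ι _ (Matrix mm mm ℂ) Matrix.frobeniusNormedAddCommGroup Matrix.frobeniusNormedSpace e * (2 * Real.sqrt (Fintype.card mm)) * (Real.sqrt (Fintype.card mm) * ((C / ξ) * Real.exp (((((L ^ kk : ℕ) : ℝ))⁻¹) * (C / ξ))))) ^ 2 + @basisConst ι _ (Matrix mm mm ℂ) Matrix.frobeniusNormedAddCommGroup Matrix.frobeniusNormedSpace e * (2 * Real.sqrt (Fintype.card mm)) * (Real.sqrt (Fintype.card mm) * ((C / ξ ^ 2) * Real.exp (((((L ^ kk : ℕ) : ℝ))⁻¹) * (C / ξ)))))) ≤ rV →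
        rV * (1 + Fintype.card (Fin (d + 1) ⊕ Fin (d + 1))) + a₀ * (Fintype.card ι * (Fintype.card ι * ((1 + rV * ((((L ^ kk : ℕ) : ℝ))⁻¹)) ^ ((d + 1) * L ^ kk) - 1) ^ 2 + 2 * ((1 + rV * ((((L ^ kk : ℕ) : ℝ))⁻¹)) ^ ((d + 1) * L ^ kk) - 1))) ≤ R₀ →
        ((1 + rV * ((((L ^ kk : ℕ) : ℝ))⁻¹)) ^ ((d + 1) * L ^ kk) - 1) ≤ R₀ →
      ∀ k : Fin (d + 1) → ZMod (2 * L), ∃ (W : Tor (cvM d L mv kk hL) → Matrix ι ι ℝ) (dZ : Tor (cvM d L mv kk hL) → ℝ),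
        (∀ y, (W y)ᵀ * W y = 1) ∧ (∀ y, W y * (W y)ᵀ = 1) ∧ (∀ y, 0 ≤ dZ y) ∧ (∀ y z, dZ y ≤ (unitTorusGeo L kk (cvM d L mv kk hL)).dist y z + dZ z) ∧
        (∀ y, scH d L mv kk hL k (up (L ^ kk) (cvM d L mv kk hL) y) ≠ 0 → ((L ^ mv : ℕ) : ℝ) ≤ dZ y) ∧
        HasMaj (BlockNorm.ofBlocks (unitTorusGeo L kk (cvM d L mv kk hL)) (liftBlk (fun y : Tor (cvM d L mv kk hL) => y) ι)) (BlockNorm.ofBlocks (unitTorusGeo L kk (cvM d L mv kk hL)) (liftBlk (fun y : Tor (cvM d L mv kk hL) => y) ι))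
          (mmulOp W ∘ₗ Matrix.mulVecLin (cSop (cvM d L mv kk hL) (L ^ kk) (cvT e (fun μ x => (U μ x : Matrix mm mm ℂ))) (aK a₀ (L : ℝ) kk * (((L ^ kk : ℕ) : ℝ)) ^ (d + 1)))⁻¹ ∘ₗ mmulOp (fun y => (W y)ᵀ) -
            Matrix.mulVecLin (cSop (cvM d L mv kk hL) (L ^ kk) (fun (_ : Fin (d + 1)) (_ : ScX d L mv kk hL) => (1 : Matrix ι ι ℝ)) (aK a₀ (L : ℝ) kk * (((L ^ kk : ℕ) : ℝ)) ^ (d + 1)))⁻¹)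
          (fun y y' => (rV * (1 + Fintype.card (Fin (d + 1) ⊕ Fin (d + 1))) + aK a₀ (L : ℝ) kk * (Fintype.card ι * (Fintype.card ι * ((1 + rV * ((((L ^ kk : ℕ) : ℝ))⁻¹)) ^ ((d + 1) * L ^ kk) - 1) ^ 2 + 2 * ((1 + rV * ((((L ^ kk : ℕ) : ℝ))⁻¹)) ^ ((d + 1) * L ^ kk) - 1))) +
              ((1 + rV * ((((L ^ kk : ℕ) : ℝ))⁻¹)) ^ ((d + 1) * L ^ kk) - 1) + (((L ^ mv : ℕ) : ℝ))⁻¹ + 1 * Real.exp (-(δ * dZ y))) *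
            (B * (((L ^ kk : ℕ) : ℝ)) ^ (d + 1) * Real.exp (-(δ * (unitTorusGeo L kk (cvM d L mv kk hL)).dist y y')))) := by
  classical
  have hL7 : 7 ≤ L := by omega
  have hL1r : (1 : ℝ) < (L : ℝ) := by exact_mod_cast hL.2
  have haKlo : ∀ K : ℕ, 1 ≤ K → a₀ / 2 ≤ aK a₀ (L : ℝ) K := fun K hK => by
    have h1 := aK_ge ha₀ hL1r hK (a := a₀)
    have hL2 : (2 : ℝ) ≤ (L : ℝ) := by exact_mod_cast (show 2 ≤ L by omega)
    have hL4 : (4 : ℝ) ≤ (L : ℝ) ^ 2 := by nlinarith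
    have hinv : ((L : ℝ) ^ 2)⁻¹ ≤ 1 / 4 := by rw [one_div]; exact inv_anti₀ (by norm_num) hL4
    have h2 := mul_le_mul_of_nonneg_left hinv ha₀.le
    nlinarith
  obtain ⟨δ₁, w₁, R₁, B₁, hδ₁, hR₁, hB₁, H₁⟩ := hasMaj_cSop_sub_cSop_one_of_reg335_scaled (d := d) hL hL7 ha₀ ι
  obtain ⟨CS, δS, hCS, hδS, HS⟩ := flatSopRow_ct_uniform (d := d) L (a₁ := a₀ / 2) (a₂ := a₀) (by positivity) (by linarith)
  obtain ⟨δI, wI, RI, BI, hδI, hRI, hBI, HI⟩ := hasMaj_cSop_inv_of_reg335BigBox (d := d) hL hL11 ha₀ ι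
  -- rates: common `δ₀`, weight rate `m = δ₀∕8`, row-sum rate `m`, two convolutions
  set δ₀ : ℝ := min δ₁ (min δS δI) with hδ₀def
  have hδ₀ : 0 < δ₀ := lt_min hδ₁ (lt_min hδS hδI)
  have hδ₀₁ : δ₀ ≤ δ₁ := min_le_left _ _
  have hδ₀S : δ₀ ≤ δS := (min_le_right _ _).trans (min_le_left _ _)
  have hδ₀I : δ₀ ≤ δI := (min_le_right _ _).trans (min_le_right _ _)
  set m : ℝ := δ₀ / 8 with hmdef
  have hm : 0 < m := by positivity
  set cr : ℝ := B4Sect5Proof.latticeConst (d + 1) m with hcrdef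
  have hcr0 : 0 ≤ cr := B4Sect5Proof.latticeConst_nonneg (d + 1) hm.le
  refine ⟨m, max w₁ wI, min R₁ RI, 1 * CS * (1 * B₁ * ((Fintype.card ι : ℝ) ^ 2 * BI) * cr) * cr + 1, hm, lt_min hR₁ hRI, by positivity, fun mv kk hk hw₀ => ?_⟩
  intro mm _ _ _ e he U hU ξ C hξ hC hbig rV hrV hrA hrC hRle hσV k
  have hw₁ : w₁ ≤ ((L ^ mv : ℕ) : ℝ) := (le_max_left _ _).trans hw₀
  have hwI : wI ≤ ((L ^ mv : ℕ) : ℝ) := (le_max_right _ _).trans hw₀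
  have hRle₁ := hRle.trans (min_le_left R₁ RI)
  have hRleI := hRle.trans (min_le_right R₁ RI)
  have hσVI := hσV.trans (min_le_right R₁ RI)
  have hd : ∀ a b : Tor (cvM d L mv kk hL), 0 ≤ (unitTorusGeo L kk (cvM d L mv kk hL)).dist a b := unitTorusGeo_dist_nonneg L kk _
  have htri : Triangle254 (unitTorusGeo L kk (cvM d L mv kk hL)) := triangle254_unitTorusGeo L kk _
  have hrow : RowSum (unitTorusGeo L kk (cvM d L mv kk hL)) m cr := by rw [hcrdef]; exact rowSum_unitTorusGeo L kk _ hm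
  have hnpos : (0 : ℝ) < ((L ^ kk : ℕ) : ℝ) ^ (d + 1) := by positivity
  have ha' : 0 < aK a₀ (L : ℝ) kk * (((L ^ kk : ℕ) : ℝ)) ^ (d + 1) := mul_pos (aK_pos ha₀ hL1r hk) hnpos
  have hU' : ∀ μ x, ((U μ x : Matrix mm mm ℂ))ᴴ * (U μ x : Matrix mm mm ℂ) = 1 := fun μ x => Matrix.mem_unitaryGroup_iff'.mp (hU μ x)
  have hκ : (BlockNorm.ofBlocks (unitTorusGeo L kk (cvM d L mv kk hL)) (liftBlk (fun y : Tor (cvM d L mv kk hL) => y) ι)).κ = 1 := kappa_ofBlocks _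
  have hrate : ∀ ⦃c ρ ρ' : ℝ⦄, 0 ≤ c → ρ' ≤ ρ → ∀ y y' : Tor (cvM d L mv kk hL), c * Real.exp (-(ρ * (unitTorusGeo L kk (cvM d L mv kk hL)).dist y y')) ≤ c * Real.exp (-(ρ' * (unitTorusGeo L kk (cvM d L mv kk hL)).dist y y')) :=
    fun c ρ ρ' hc hρ y y' => mul_le_mul_of_nonneg_left (Real.exp_le_exp.mpr (by nlinarith only [hd y y', hρ])) hc
  -- the cube's gauge, the far zone, the gauged field
  obtain ⟨u, A, hu, hg, hA, hD⟩ := hbig k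
  obtain ⟨Z, dZ, hdZ, hdZ0, hdZl, hmarg, hnear⟩ := exists_farZone (d := d) hL hL11 mv kk k
  have hu' : ∀ x, ((u x : Matrix mm mm ℂ))ᴴ * (u x : Matrix mm mm ℂ) = 1 := fun x => Matrix.mem_unitaryGroup_iff'.mp (hu x)
  have hu1 : ∀ x, ‖(u x : Matrix mm mm ℂ)‖ ≤ 1 ∧ ‖(((u x)⁻¹ : (Matrix mm mm ℂ)ˣ) : Matrix mm mm ℂ)‖ ≤ 1 := fun x =>
    ⟨(CStarRing.norm_of_mem_unitary (hu x)).le, by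
      rw [uN_val_inv_eq_conjTranspose (hu x)]
      exact (CStarRing.norm_of_mem_unitary (Unitary.star_mem (hu x))).le⟩
  set V : Fin (d + 1) → ScX d L mv kk hL → (Matrix mm mm ℂ)ˣ := gaugeTr (scShift d L mv kk hL) u U with hVdef
  have hVu : ∀ μ x, (V μ x : Matrix mm mm ℂ) ∈ Matrix.unitaryGroup mm ℂ := fun μ x => by
    rw [hVdef, uN_val_gaugeTr_eq (T := scShift d L mv kk hL) U (hu (scShift d L mv kk hL μ x))]
    exact Submonoid.mul_mem _ (Submonoid.mul_mem _ (hu x) (hU μ x)) (Unitary.star_mem (hu (scShift d L mv kk hL μ x)))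
  have hVval : (fun μ x => (V μ x : Matrix mm mm ℂ)) = scGaugeU d L mv kk hL (fun x => (u x : Matrix mm mm ℂ)) (fun μ x => (U μ x : Matrix mm mm ℂ)) := by
    funext μ x
    rw [hVdef, uN_val_gaugeTr_eq (T := scShift d L mv kk hL) U (hu (scShift d L mv kk hL μ x))]
    rfl
  have hboxV : ∀ k', Reg335Cube (scShift d L mv kk hL) V ((((L ^ kk : ℕ) : ℝ))⁻¹) {x : ScX d L mv kk hL | blockOf (L ^ kk) (cvM d L mv kk hL) x ∈ cubeBlocks (cvM d L mv kk hL) (coverCorner (cvM d L mv kk hL) (L ^ mv) L (2 * L ^ mv + 1) k') (6 * L ^ mv + 3)} ξ C :=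
    fun k' => reg335Cube_gaugeTr (scShift d L mv kk hL) (fun z _ => hu1 z) (reg335Cube_box2_of_bigBox (d := d) hL hL11 mv kk U (ξ := ξ) (C := C) k' (hbig k'))
  have hnearV : ∀ k', ¬ (cvSk d L mv kk hL k' ⊆ Z) → ∃ A' : Fin (d + 1) → ScX d L mv kk hL → Matrix mm mm ℂ,
      (∀ μ, ∀ z ∈ {x : ScX d L mv kk hL | blockOf (L ^ kk) (cvM d L mv kk hL) x ∈ cubeBlocks (cvM d L mv kk hL) (coverCorner (cvM d L mv kk hL) (L ^ mv) L (2 * L ^ mv + 1) k') (6 * L ^ mv + 3)}, gaugeTr (scShift d L mv kk hL) (fun _ => (1 : (Matrix mm mm ℂ)ˣ)) V μ z = fluct ((((L ^ kk : ℕ) : ℝ))⁻¹) A' μ z) ∧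
      (∀ μ, ∀ z ∈ {x : ScX d L mv kk hL | blockOf (L ^ kk) (cvM d L mv kk hL) x ∈ cubeBlocks (cvM d L mv kk hL) (coverCorner (cvM d L mv kk hL) (L ^ mv) L (2 * L ^ mv + 1) k') (6 * L ^ mv + 3)}, ‖A' μ z‖ < C * ξ⁻¹) ∧
      (∀ μ ν, ∀ z ∈ {x : ScX d L mv kk hL | blockOf (L ^ kk) (cvM d L mv kk hL) x ∈ cubeBlocks (cvM d L mv kk hL) (coverCorner (cvM d L mv kk hL) (L ^ mv) L (2 * L ^ mv + 1) k') (6 * L ^ mv + 3)}, ‖((↑((((L ^ kk : ℕ) : ℝ))⁻¹) : ℂ)⁻¹) • covD (scShift d L mv kk hL) (fun _ _ => (1 : (Matrix mm mm ℂ)ˣ)) μ (A' ν) z‖ < C * (ξ ^ 2)⁻¹) := fun k' hk' =>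
    ⟨A, fun μ z hz => by rw [gaugeTr_one]; exact hg μ z (hnear k' hk' hz), fun μ z hz => hA μ z (hnear k' hk' hz), fun μ ν z hz => hD μ ν z (hnear k' hk' hz)⟩
  -- the coarse gauge and the conjugation identities
  set W : Tor (cvM d L mv kk hL) → Matrix ι ι ℝ := fun y => coordMat e (ContinuousLinearMap.mulLeftRight ℝ (Matrix mm mm ℂ) (u (bpt (L ^ kk) (cvM d L mv kk hL) y 0) : Matrix mm mm ℂ) ((u (bpt (L ^ kk) (cvM d L mv kk hL) y 0) : Matrix mm mm ℂ))ᴴ) with hWdef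
  have hWo : ∀ y, (W y)ᵀ * W y = 1 ∧ W y * (W y)ᵀ = 1 := fun y => uN_coordMat_conj_orthogonal e he (hu' _)
  have hconj : mmulOp W ∘ₗ Matrix.mulVecLin (cSop (cvM d L mv kk hL) (L ^ kk) (cvT e (fun μ x => (U μ x : Matrix mm mm ℂ))) (aK a₀ (L : ℝ) kk * (((L ^ kk : ℕ) : ℝ)) ^ (d + 1))) ∘ₗ mmulOp (fun y => (W y)ᵀ) =
      Matrix.mulVecLin (cSop (cvM d L mv kk hL) (L ^ kk) (cvT e (fun μ x => (V μ x : Matrix mm mm ℂ))) (aK a₀ (L : ℝ) kk * (((L ^ kk : ℕ) : ℝ)) ^ (d + 1))) := by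
    have hW0 : ∀ x : ScX d L mv kk hL, (coordMat e (ContinuousLinearMap.mulLeftRight ℝ (Matrix mm mm ℂ) (u x : Matrix mm mm ℂ) ((u x : Matrix mm mm ℂ))ᴴ))ᵀ *
        coordMat e (ContinuousLinearMap.mulLeftRight ℝ (Matrix mm mm ℂ) (u x : Matrix mm mm ℂ) ((u x : Matrix mm mm ℂ))ᴴ) = 1 := fun x => (uN_coordMat_conj_orthogonal e he (hu' x)).1
    rw [hVval, cvT_scGaugeU ι e he hu' (fun μ x => (U μ x : Matrix mm mm ℂ)), cSop_gauge (cvM d L mv kk hL) (L ^ kk) hW0, mmulOp_eq_mulVecLin_bdiag, mmulOp_eq_mulVecLin_bdiag,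
      ← Matrix.mulVecLin_mul, ← Matrix.mulVecLin_mul, ← bdiag_transpose]
    rw [Matrix.mul_assoc]
  have hWW : mmulOp (fun y => (W y)ᵀ) ∘ₗ mmulOp W = LinearMap.id := by
    rw [mmulOp_comp_mmulOp, show (fun y => (W y)ᵀ * W y) = fun _ => (1 : Matrix ι ι ℝ) from funext fun y => (hWo y).1, mmulOp_one]
  -- the three operators
  obtain ⟨SUi, hSUi⟩ : ∃ SUi : (Tor (cvM d L mv kk hL) × ι → ℝ) →ₗ[ℝ] (Tor (cvM d L mv kk hL) × ι → ℝ), SUi = Matrix.mulVecLin (cSop (cvM d L mv kk hL) (L ^ kk) (cvT e (fun μ x => (U μ x : Matrix mm mm ℂ))) (aK a₀ (L : ℝ) kk * (((L ^ kk : ℕ) : ℝ)) ^ (d + 1)))⁻¹ := ⟨_, rfl⟩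
  obtain ⟨SV, hSV⟩ : ∃ SV : (Tor (cvM d L mv kk hL) × ι → ℝ) →ₗ[ℝ] (Tor (cvM d L mv kk hL) × ι → ℝ), SV = Matrix.mulVecLin (cSop (cvM d L mv kk hL) (L ^ kk) (cvT e (fun μ x => (V μ x : Matrix mm mm ℂ))) (aK a₀ (L : ℝ) kk * (((L ^ kk : ℕ) : ℝ)) ^ (d + 1))) := ⟨_, rfl⟩
  obtain ⟨S1, hS1⟩ : ∃ S1 : (Tor (cvM d L mv kk hL) × ι → ℝ) →ₗ[ℝ] (Tor (cvM d L mv kk hL) × ι → ℝ), S1 = Matrix.mulVecLin (cSop (cvM d L mv kk hL) (L ^ kk) (fun (_ : Fin (d + 1)) (_ : ScX d L mv kk hL) => (1 : Matrix ι ι ℝ)) (aK a₀ (L : ℝ) kk * (((L ^ kk : ℕ) : ℝ)) ^ (d + 1))) := ⟨_, rfl⟩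
  obtain ⟨S1i, hS1i⟩ : ∃ S1i : (Tor (cvM d L mv kk hL) × ι → ℝ) →ₗ[ℝ] (Tor (cvM d L mv kk hL) × ι → ℝ), S1i = Matrix.mulVecLin (cSop (cvM d L mv kk hL) (L ^ kk) (fun (_ : Fin (d + 1)) (_ : ScX d L mv kk hL) => (1 : Matrix ι ι ℝ)) (aK a₀ (L : ℝ) kk * (((L ^ kk : ℕ) : ℝ)) ^ (d + 1)))⁻¹ := ⟨_, rfl⟩
  have hunitU : IsUnit (cSop (cvM d L mv kk hL) (L ^ kk) (cvT e (fun μ x => (U μ x : Matrix mm mm ℂ))) (aK a₀ (L : ℝ) kk * (((L ^ kk : ℕ) : ℝ)) ^ (d + 1))) :=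
    isUnit_cSop (cvM d L mv kk hL) (L ^ kk) (isUnit_cvT ι e he (fun μ x => (U μ x : Matrix mm mm ℂ)) hU') ha'
  have hunit1 : IsUnit (cSop (cvM d L mv kk hL) (L ^ kk) (fun (_ : Fin (d + 1)) (_ : ScX d L mv kk hL) => (1 : Matrix ι ι ℝ)) (aK a₀ (L : ℝ) kk * (((L ^ kk : ℕ) : ℝ)) ^ (d + 1))) :=
    isUnit_cSop (cvM d L mv kk hL) (L ^ kk) (fun _ _ => isUnit_one) ha'
  have hSSi : Matrix.mulVecLin (cSop (cvM d L mv kk hL) (L ^ kk) (cvT e (fun μ x => (U μ x : Matrix mm mm ℂ))) (aK a₀ (L : ℝ) kk * (((L ^ kk : ℕ) : ℝ)) ^ (d + 1))) ∘ₗ SUi = LinearMap.id := by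
    rw [hSUi, ← Matrix.mulVecLin_mul, Matrix.mul_nonsing_inv _ ((Matrix.isUnit_iff_isUnit_det _).mp hunitU), Matrix.mulVecLin_one]
  have hS1iS : S1i ∘ₗ S1 = LinearMap.id := by
    rw [hS1i, hS1, ← Matrix.mulVecLin_mul, Matrix.nonsing_inv_mul _ ((Matrix.isUnit_iff_isUnit_det _).mp hunit1), Matrix.mulVecLin_one]
  -- `𝕎S(U)⁻¹𝕎ᵀ − S(𝟙)⁻¹ = S(𝟙)⁻¹ ∘ (S(𝟙) − S(V)) ∘ (𝕎S(U)⁻¹𝕎ᵀ)`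
  have hVinv : SV ∘ₗ (mmulOp W ∘ₗ SUi ∘ₗ mmulOp (fun y => (W y)ᵀ)) = LinearMap.id := by
    rw [hSV, ← hconj]
    calc (mmulOp W ∘ₗ Matrix.mulVecLin (cSop (cvM d L mv kk hL) (L ^ kk) (cvT e (fun μ x => (U μ x : Matrix mm mm ℂ))) (aK a₀ (L : ℝ) kk * (((L ^ kk : ℕ) : ℝ)) ^ (d + 1))) ∘ₗ mmulOp (fun y => (W y)ᵀ)) ∘ₗ (mmulOp W ∘ₗ SUi ∘ₗ mmulOp (fun y => (W y)ᵀ))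
        = mmulOp W ∘ₗ (Matrix.mulVecLin (cSop (cvM d L mv kk hL) (L ^ kk) (cvT e (fun μ x => (U μ x : Matrix mm mm ℂ))) (aK a₀ (L : ℝ) kk * (((L ^ kk : ℕ) : ℝ)) ^ (d + 1))) ∘ₗ ((mmulOp (fun y => (W y)ᵀ) ∘ₗ mmulOp W) ∘ₗ SUi)) ∘ₗ mmulOp (fun y => (W y)ᵀ) := by
          simp only [LinearMap.comp_assoc]
      _ = LinearMap.id := by
          rw [hWW, LinearMap.id_comp, hSSi, LinearMap.id_comp, mmulOp_comp_mmulOp,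
            show (fun y => W y * (W y)ᵀ) = fun _ => (1 : Matrix ι ι ℝ) from funext fun y => (hWo y).2, mmulOp_one]
  have hid : mmulOp W ∘ₗ SUi ∘ₗ mmulOp (fun y => (W y)ᵀ) - S1i = S1i ∘ₗ ((S1 - SV) ∘ₗ (mmulOp W ∘ₗ SUi ∘ₗ mmulOp (fun y => (W y)ᵀ))) := by
    rw [LinearMap.sub_comp, LinearMap.comp_sub, hVinv, LinearMap.comp_id]
    congr 1
    conv_rhs => rw [← LinearMap.comp_assoc, hS1iS, LinearMap.id_comp]
  -- the three majorants
  have hS1ρ : HasMaj (BlockNorm.ofBlocks (unitTorusGeo L kk (cvM d L mv kk hL)) (liftBlk (fun y : Tor (cvM d L mv kk hL) => y) ι)) (BlockNorm.ofBlocks (unitTorusGeo L kk (cvM d L mv kk hL)) (liftBlk (fun y : Tor (cvM d L mv kk hL) => y) ι))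
      S1i (fun y y' => CS * (((L ^ kk : ℕ) : ℝ)) ^ (d + 1) * Real.exp (-(δ₀ * (unitTorusGeo L kk (cvM d L mv kk hL)).dist y y'))) := by
    rw [hS1i]
    exact (HS (aK a₀ (L : ℝ) kk) (haKlo kk hk) (aK_le ha₀ hL1r hk) (cvM d L mv kk hL) (L ^ kk) kk ι).mono (hrate (c := CS * (((L ^ kk : ℕ) : ℝ)) ^ (d + 1)) (ρ := δS) (ρ' := δ₀) (by positivity) hδ₀S)
  have hAinv : HasMaj (BlockNorm.ofBlocks (unitTorusGeo L kk (cvM d L mv kk hL)) (liftBlk (fun y : Tor (cvM d L mv kk hL) => y) ι)) (BlockNorm.ofBlocks (unitTorusGeo L kk (cvM d L mv kk hL)) (liftBlk (fun y : Tor (cvM d L mv kk hL) => y) ι))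
      (mmulOp W ∘ₗ SUi ∘ₗ mmulOp (fun y => (W y)ᵀ)) (fun y y' => (Fintype.card ι : ℝ) ^ 2 * BI * (((L ^ kk : ℕ) : ℝ)) ^ (d + 1) * Real.exp (-(δ₀ * (unitTorusGeo L kk (cvM d L mv kk hL)).dist y y'))) := by
    rw [hSUi]
    have h := HI mv kk hk hwI e he U hU ξ C hξ hC hbig rV hrV hrA hrC hRleI hσVI
    have h2 := hasMaj_gaugeConj (g := unitTorusGeo L kk (cvM d L mv kk hL)) (fun y : Tor (cvM d L mv kk hL) => y) W (fun y => (hWo y).2) (fun y => (hWo y).1) (fun y y' => by positivity) h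
    refine h2.mono fun y y' => ?_
    rw [← mul_assoc, ← mul_assoc]
    exact hrate (c := (Fintype.card ι : ℝ) ^ 2 * BI * (((L ^ kk : ℕ) : ℝ)) ^ (d + 1)) (ρ := δI) (ρ' := δ₀) (by positivity) hδ₀I y y'
  have hSIG0 : 0 ≤ ((1 + rV * ((((L ^ kk : ℕ) : ℝ))⁻¹)) ^ ((d + 1) * L ^ kk) - 1) := by
    have := one_le_pow₀ (M₀ := ℝ) (a := 1 + rV * ((((L ^ kk : ℕ) : ℝ))⁻¹)) (le_add_of_nonneg_right (by positivity)) (n := (d + 1) * L ^ kk); linarith only [this]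
  have hSum0 : 0 ≤ rV * (1 + Fintype.card (Fin (d + 1) ⊕ Fin (d + 1))) + aK a₀ (L : ℝ) kk * (Fintype.card ι * (Fintype.card ι * ((1 + rV * ((((L ^ kk : ℕ) : ℝ))⁻¹)) ^ ((d + 1) * L ^ kk) - 1) ^ 2 + 2 * ((1 + rV * ((((L ^ kk : ℕ) : ℝ))⁻¹)) ^ ((d + 1) * L ^ kk) - 1))) +
      ((1 + rV * ((((L ^ kk : ℕ) : ℝ))⁻¹)) ^ ((d + 1) * L ^ kk) - 1) + (((L ^ mv : ℕ) : ℝ))⁻¹ := by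
    have haK := aK_pos ha₀ hL1r hk
    exact add_nonneg (add_nonneg (add_nonneg (mul_nonneg hrV (by positivity)) (mul_nonneg haK.le (mul_nonneg (Nat.cast_nonneg _) (add_nonneg (by positivity) (mul_nonneg zero_le_two hSIG0))))) hSIG0) (by positivity)
  have hD : HasMaj (BlockNorm.ofBlocks (unitTorusGeo L kk (cvM d L mv kk hL)) (liftBlk (fun y : Tor (cvM d L mv kk hL) => y) ι)) (BlockNorm.ofBlocks (unitTorusGeo L kk (cvM d L mv kk hL)) (liftBlk (fun y : Tor (cvM d L mv kk hL) => y) ι))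
      (S1 - SV)
      (fun y y' => (rV * (1 + Fintype.card (Fin (d + 1) ⊕ Fin (d + 1))) + aK a₀ (L : ℝ) kk * (Fintype.card ι * (Fintype.card ι * ((1 + rV * ((((L ^ kk : ℕ) : ℝ))⁻¹)) ^ ((d + 1) * L ^ kk) - 1) ^ 2 + 2 * ((1 + rV * ((((L ^ kk : ℕ) : ℝ))⁻¹)) ^ ((d + 1) * L ^ kk) - 1))) +
          ((1 + rV * ((((L ^ kk : ℕ) : ℝ))⁻¹)) ^ ((d + 1) * L ^ kk) - 1) + (((L ^ mv : ℕ) : ℝ))⁻¹ + 1 * Real.exp (-(δ₀ * dZ y))) *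
        (B₁ * ((((L ^ kk : ℕ) : ℝ)) ^ (d + 1))⁻¹ * Real.exp (-(δ₀ * (unitTorusGeo L kk (cvM d L mv kk hL)).dist y y')))) := by
    have h := H₁ mv kk hk hw₁ e he (fun k' => cvSk d L mv kk hL k' ⊆ Z) Z dZ hdZ hdZ0 hdZl (fun k' hk' => hk') V hVu ξ C hξ hC (fun k' _ => hboxV k') hnearV rV hrV hrA hrC hRle₁
    rw [← hSV, ← hS1] at h
    have h' := h.neg
    rw [neg_sub] at h'
    refine h'.mono fun y y' => ?_
    have hE := Real.exp_nonneg (-(δ₀ * (unitTorusGeo L kk (cvM d L mv kk hL)).dist y y'))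
    have hE' := Real.exp_nonneg (-(δ₀ * dZ y))
    have h1 : Real.exp (-(δ₁ * (unitTorusGeo L kk (cvM d L mv kk hL)).dist y y')) ≤ Real.exp (-(δ₀ * (unitTorusGeo L kk (cvM d L mv kk hL)).dist y y')) :=
      Real.exp_le_exp.2 (by nlinarith [hd y y', hδ₀₁])
    have h2 : Real.exp (-(δ₁ * dZ y)) ≤ Real.exp (-(δ₀ * dZ y)) := Real.exp_le_exp.2 (by nlinarith [hdZ0 y, hδ₀₁])
    calc B₁ * ((((L ^ kk : ℕ) : ℝ)) ^ (d + 1))⁻¹ * (rV * (1 + Fintype.card (Fin (d + 1) ⊕ Fin (d + 1))) + aK a₀ (L : ℝ) kk * (Fintype.card ι * (Fintype.card ι * ((1 + rV * ((((L ^ kk : ℕ) : ℝ))⁻¹)) ^ ((d + 1) * L ^ kk) - 1) ^ 2 + 2 * ((1 + rV * ((((L ^ kk : ℕ) : ℝ))⁻¹)) ^ ((d + 1) * L ^ kk) - 1))) +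
            ((1 + rV * ((((L ^ kk : ℕ) : ℝ))⁻¹)) ^ ((d + 1) * L ^ kk) - 1) + (((L ^ mv : ℕ) : ℝ))⁻¹ + Real.exp (-(δ₁ * dZ y))) * Real.exp (-(δ₁ * (unitTorusGeo L kk (cvM d L mv kk hL)).dist y y'))
        ≤ B₁ * ((((L ^ kk : ℕ) : ℝ)) ^ (d + 1))⁻¹ * (rV * (1 + Fintype.card (Fin (d + 1) ⊕ Fin (d + 1))) + aK a₀ (L : ℝ) kk * (Fintype.card ι * (Fintype.card ι * ((1 + rV * ((((L ^ kk : ℕ) : ℝ))⁻¹)) ^ ((d + 1) * L ^ kk) - 1) ^ 2 + 2 * ((1 + rV * ((((L ^ kk : ℕ) : ℝ))⁻¹)) ^ ((d + 1) * L ^ kk) - 1))) +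
            ((1 + rV * ((((L ^ kk : ℕ) : ℝ))⁻¹)) ^ ((d + 1) * L ^ kk) - 1) + (((L ^ mv : ℕ) : ℝ))⁻¹ + Real.exp (-(δ₀ * dZ y))) * Real.exp (-(δ₀ * (unitTorusGeo L kk (cvM d L mv kk hL)).dist y y')) := by gcongr
      _ = _ := by ring
  -- compose: `(S(𝟙) − S(V)) ∘ A⁻¹` with the weight at the output, then `S(𝟙)⁻¹ ∘ (…)` moving the weight to the output (Lipschitz `d_Z`)
  have hDA := hasMaj_nfW_comp_exp (u := fun y => rV * (1 + Fintype.card (Fin (d + 1) ⊕ Fin (d + 1))) + aK a₀ (L : ℝ) kk * (Fintype.card ι * (Fintype.card ι * ((1 + rV * ((((L ^ kk : ℕ) : ℝ))⁻¹)) ^ ((d + 1) * L ^ kk) - 1) ^ 2 + 2 * ((1 + rV * ((((L ^ kk : ℕ) : ℝ))⁻¹)) ^ ((d + 1) * L ^ kk) - 1))) +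
      ((1 + rV * ((((L ^ kk : ℕ) : ℝ))⁻¹)) ^ ((d + 1) * L ^ kk) - 1) + (((L ^ mv : ℕ) : ℝ))⁻¹ + 1 * Real.exp (-(δ₀ * dZ y)))
    (ρ := δ₀ - 2 * m) htri hd hrow (fun y => add_nonneg hSum0 (by positivity)) (by positivity) (by positivity) (by rw [hmdef]; linarith) (by rw [hmdef]; linarith) (by rw [hmdef]; linarith) hD hAinv
  have hfin := hasMaj_comp_nfW dZ (s := rV * (1 + Fintype.card (Fin (d + 1) ⊕ Fin (d + 1))) + aK a₀ (L : ℝ) kk * (Fintype.card ι * (Fintype.card ι * ((1 + rV * ((((L ^ kk : ℕ) : ℝ))⁻¹)) ^ ((d + 1) * L ^ kk) - 1) ^ 2 + 2 * ((1 + rV * ((((L ^ kk : ℕ) : ℝ))⁻¹)) ^ ((d + 1) * L ^ kk) - 1))) +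
      ((1 + rV * ((((L ^ kk : ℕ) : ℝ))⁻¹)) ^ ((d + 1) * L ^ kk) - 1) + (((L ^ mv : ℕ) : ℝ))⁻¹) (f := 1) (c := δ₀) (m := m) (ρ := δ₀ - 4 * m)
    htri hd hrow hdZl hdZ0 (by positivity) (mul_nonneg (mul_nonneg (mul_nonneg (BlockNorm.κ_nonneg _) (by positivity)) (by positivity)) hcr0) hSum0 zero_le_one hm.le (by rw [hmdef]; linarith) (by rw [hmdef]; linarith) (by rw [hmdef]; linarith) (by rw [hmdef]; linarith) hS1ρ hDA
  refine ⟨W, dZ, fun y => (hWo y).1, fun y => (hWo y).2, hdZ0, hdZl, fun y hy => ?_, ?_⟩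
  · rw [← blockOf_up (n := L ^ kk) y]; exact hmarg _ hy
  · rw [← hSUi, ← hS1i, hid]
    refine hfin.mono fun y y' => ?_
    rw [hκ]
    have hE := Real.exp_nonneg (-((δ₀ - 4 * m) * (unitTorusGeo L kk (cvM d L mv kk hL)).dist y y'))
    have hE' := Real.exp_nonneg (-(m * dZ y))
    have hex : Real.exp (-((δ₀ - 4 * m) * (unitTorusGeo L kk (cvM d L mv kk hL)).dist y y')) ≤ Real.exp (-(m * (unitTorusGeo L kk (cvM d L mv kk hL)).dist y y')) :=
      Real.exp_le_exp.2 (by rw [hmdef]; nlinarith [hd y y', hδ₀])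
    have hnn : ((((L ^ kk : ℕ) : ℝ)) ^ (d + 1))⁻¹ * (((L ^ kk : ℕ) : ℝ)) ^ (d + 1) = 1 := inv_mul_cancel₀ hnpos.ne'
    have hw0 : 0 ≤ rV * (1 + Fintype.card (Fin (d + 1) ⊕ Fin (d + 1))) + aK a₀ (L : ℝ) kk * (Fintype.card ι * (Fintype.card ι * ((1 + rV * ((((L ^ kk : ℕ) : ℝ))⁻¹)) ^ ((d + 1) * L ^ kk) - 1) ^ 2 + 2 * ((1 + rV * ((((L ^ kk : ℕ) : ℝ))⁻¹)) ^ ((d + 1) * L ^ kk) - 1))) +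
        ((1 + rV * ((((L ^ kk : ℕ) : ℝ))⁻¹)) ^ ((d + 1) * L ^ kk) - 1) + (((L ^ mv : ℕ) : ℝ))⁻¹ + 1 * Real.exp (-(m * dZ y)) := add_nonneg hSum0 (by positivity)
    calc (rV * (1 + Fintype.card (Fin (d + 1) ⊕ Fin (d + 1))) + aK a₀ (L : ℝ) kk * (Fintype.card ι * (Fintype.card ι * ((1 + rV * ((((L ^ kk : ℕ) : ℝ))⁻¹)) ^ ((d + 1) * L ^ kk) - 1) ^ 2 + 2 * ((1 + rV * ((((L ^ kk : ℕ) : ℝ))⁻¹)) ^ ((d + 1) * L ^ kk) - 1))) +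
          ((1 + rV * ((((L ^ kk : ℕ) : ℝ))⁻¹)) ^ ((d + 1) * L ^ kk) - 1) + (((L ^ mv : ℕ) : ℝ))⁻¹ + 1 * Real.exp (-(m * dZ y))) *
          (1 * (CS * (((L ^ kk : ℕ) : ℝ)) ^ (d + 1)) * (1 * (B₁ * ((((L ^ kk : ℕ) : ℝ)) ^ (d + 1))⁻¹) * ((Fintype.card ι : ℝ) ^ 2 * BI * (((L ^ kk : ℕ) : ℝ)) ^ (d + 1)) * cr) * cr * Real.exp (-((δ₀ - 4 * m) * (unitTorusGeo L kk (cvM d L mv kk hL)).dist y y')))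
        = (rV * (1 + Fintype.card (Fin (d + 1) ⊕ Fin (d + 1))) + aK a₀ (L : ℝ) kk * (Fintype.card ι * (Fintype.card ι * ((1 + rV * ((((L ^ kk : ℕ) : ℝ))⁻¹)) ^ ((d + 1) * L ^ kk) - 1) ^ 2 + 2 * ((1 + rV * ((((L ^ kk : ℕ) : ℝ))⁻¹)) ^ ((d + 1) * L ^ kk) - 1))) +
          ((1 + rV * ((((L ^ kk : ℕ) : ℝ))⁻¹)) ^ ((d + 1) * L ^ kk) - 1) + (((L ^ mv : ℕ) : ℝ))⁻¹ + 1 * Real.exp (-(m * dZ y))) *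
          ((1 * CS * (1 * B₁ * ((Fintype.card ι : ℝ) ^ 2 * BI) * cr) * cr) * (((((L ^ kk : ℕ) : ℝ)) ^ (d + 1))⁻¹ * (((L ^ kk : ℕ) : ℝ)) ^ (d + 1)) * (((L ^ kk : ℕ) : ℝ)) ^ (d + 1) * Real.exp (-((δ₀ - 4 * m) * (unitTorusGeo L kk (cvM d L mv kk hL)).dist y y'))) := by ring
      _ ≤ _ := by
          rw [hnn, mul_one]
          have hK0 : 0 ≤ 1 * CS * (1 * B₁ * ((Fintype.card ι : ℝ) ^ 2 * BI) * cr) * cr := by positivity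
          refine mul_le_mul_of_nonneg_left ?_ hw0
          calc 1 * CS * (1 * B₁ * ((Fintype.card ι : ℝ) ^ 2 * BI) * cr) * cr * (((L ^ kk : ℕ) : ℝ)) ^ (d + 1) * Real.exp (-((δ₀ - 4 * m) * (unitTorusGeo L kk (cvM d L mv kk hL)).dist y y'))
              ≤ 1 * CS * (1 * B₁ * ((Fintype.card ι : ℝ) ^ 2 * BI) * cr) * cr * (((L ^ kk : ℕ) : ℝ)) ^ (d + 1) * Real.exp (-(m * (unitTorusGeo L kk (cvM d L mv kk hL)).dist y y')) :=
                mul_le_mul_of_nonneg_left hex (by positivity)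
            _ ≤ (1 * CS * (1 * B₁ * ((Fintype.card ι : ℝ) ^ 2 * BI) * cr) * cr + 1) * (((L ^ kk : ℕ) : ℝ)) ^ (d + 1) * Real.exp (-(m * (unitTorusGeo L kk (cvM d L mv kk hL)).dist y y')) := by
                gcongr; linarith

end Close

end Summit.QuantumFields.YangMills.BalabanUVNodes.N15.Gluing

end
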